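import Literature.AlgebraicGeometry.Resolution.NormalizationOfVarieties
import Literature.AlgebraicGeometry.Resolution.NormalizationOfVarietiesProofs
import Literature.AlgebraicGeometry.Resolution.ResolutionOfSingularities
import Literature.AlgebraicGeometry.Resolution.AffineBlowup
import Mathlib.AlgebraicGeometry.Morphisms.Finite
import Mathlib.AlgebraicGeometry.Morphisms.Proper
import Mathlib.AlgebraicGeometry.FunctionField
import Mathlib.RingTheory.RegularLocalRing.Defs
import Mathlib.RingTheory.Localization.Integral
import Mathlib.RingTheory.Localization.Finiteness
import HarnessLib

/-!
# One-dimensional variety germs have a finite birational regular model: their normalisation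
(crux `FrobeniusLadder.FRationalModification`, stmt-ResolutionOfSingularities-15316, line
`socle-discrepancy-certificate`, wave 3, registered sub-goal `regularModel_of_ringKrullDim_eq_one`)

The line `socle-discrepancy-certificate` produces local certified models at isolated-defect variety
germs `R`; its open residue stub `stub_isolatedSingularityResidual` asks for a proper birational model of
`Spec R` with good stalks. This file settles the DIMENSION-ONE case unconditionally and in the strongest
form (all stalks regular local rings): a one-dimensional Noetherian local domain `R` which is a local
ring `𝒪_{Y,y}` of an integral scheme `Y` locally of finite type over a field is resolved by its
normalisation `Spec R̃ → Spec R`, `R̃` the integral closure of `R` in its fraction field `K`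
(Kollár 2007, §1.4: for curves "the normalization gives the resolution" — Thm. 1.30, normal
Noetherian domains of dimension one are regular, and Thm. 1.33, finiteness of the normalization of
rings essentially of finite type over a field).

* `module_finite_integralClosure_of_isLocalization` — finiteness of the normalisation LOCALIZES:
  if `B = M⁻¹A` and the integral closure of `A` in a field `L ⊇ B` is a finite `A`-module, the
  integral closure of `B` in `L` is a finite `B`-module (integral closure commutes with localization,
  Mathlib `IsLocalization.integralClosure`, plus `Module.Finite.of_isLocalization`).
* `isLocalization_away_of_ringKrullDim_le_one` — in a local domain of dimension `≤ 1` every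
  non-zero `a ∈ 𝔪` has `√(b) ∋ a` for all `b ≠ 0`, so `K = R[1/a]`;
  `isLocalization_away_of_intermediate` — then also `K = B[1/a]` for every ring `R ⊆ B ⊆ K`.
* `isRegular_Spec_of_isRegularRing` — `Spec` of a regular ring (e.g. a Dedekind domain) is a regular
  scheme (stalks are the localizations at primes).
* `hasResolution_Spec_of_finite_integralClosure` — for a one-dimensional Noetherian local domain `R`
  whose normalisation `R̃ ⊆ K` is a finite `R`-module, `Spec R̃ → Spec R` is a resolution of
  singularities (`Scheme.HasResolution`): finite, hence proper; an isomorphism over the dense open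
  `D(a) = {generic point}` (`0 ≠ a ∈ 𝔪`), whose preimage `D(a) ⊆ Spec R̃` is dense, because both are
  `Spec K` (`R[1/a] = K = R̃[1/a]`, restriction criterion `isIso_morphismRestrict_of_isOpenImmersion`);
  and `R̃` is a Dedekind domain (`isDedekindDomain_integralClosure`), hence regular.
* `regularModel_of_ringKrullDim_eq_one` — the registered form, verbatim. The germ hypothesis `hgerm`
  (`R ≃ 𝒪_{Y,y}`, `Y` integral and locally of finite type over a field `k`) makes `R` the localization
  `A_𝔭` of the coordinate ring `A = Γ(Y, U)` of an affine neighbourhood of `y`, a finitely generated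
  `k`-domain with fraction field `K(Y)`; E. Noether's finiteness theorem
  (`NoetherFiniteIntegralClosure_holds`, proved in the tree) gives the finiteness of the normalisation
  of `A`, which localizes to `R`. (The characteristic `p`, separatedness and quasi-compactness in the
  registered signature are not used.)

References: J. Kollár, *Lectures on Resolution of Singularities*, Ann. of Math. Stud. 166 (2007), §1.4,
Thm. 1.30, Thm. 1.33 [Kollar2007]; Q. Liu, *Algebraic Geometry and Arithmetic Curves* (2002),
Prop. 4.1.27, Cor. 4.1.30 [Liu2002]; The Stacks Project, Tag 01RN (birational) [StacksProject].
No named fact is introduced; everything here is proved.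
-/

-- single-problem summit: the doubled namespace component `ResolutionOfSingularities` is forced
set_option linter.dupNamespace false

noncomputable section

open CategoryTheory AlgebraicGeometry TopologicalSpace
open Literature.AlgebraicGeometry.Resolution

namespace Summit.ResolutionOfSingularities.ResolutionOfSingularities.Theorems.FRationalModification.RegularModelDimOne

universe u

/-! ## Finiteness of the normalisation localizes -/

/-- **Finiteness of the normalisation localizes.** Let `B = M⁻¹A` be a localization of `A`, `L` a
field and `A → B → L` a tower. If the integral closure of `A` in `L` is a finite `A`-module, then the
integral closure of `B` in `L` is a finite `B`-module: it is the localization at `M` of the integral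
closure of `A` (integral closure commutes with localization), and finiteness is preserved by
localization. [folklore] -/
theorem module_finite_integralClosure_of_isLocalization {A B L : Type*} [CommRing A] [CommRing B]
    [Field L] [Algebra A B] [Algebra A L] [Algebra B L] [IsScalarTower A B L] (M : Submonoid A)
    [IsLocalization M B] (hfin : Module.Finite A (integralClosure A L)) :
    Module.Finite B (integralClosure B L) := by
  haveI := hfin
  -- `L` is its own localization at the image of `M`
  haveI : IsLocalization (Algebra.algebraMapSubmonoid L M) L := by
    refine IsLocalization.self ?_
    rintro _ ⟨m, hm, rfl⟩
    change IsUnit (algebraMap A L m)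
    rw [IsScalarTower.algebraMap_apply A B L]
    exact (IsLocalization.map_units B ⟨m, hm⟩).map (algebraMap B L)
  -- the inclusion of the two integral closures
  let ι : integralClosure A L →+* integralClosure B L :=
    { toFun := fun x => ⟨(x : L), IsIntegral.tower_top (A := B) x.2⟩
      map_one' := rfl
      map_zero' := rfl
      map_mul' := fun _ _ => rfl
      map_add' := fun _ _ => rfl }
  letI : Algebra (integralClosure A L) (integralClosure B L) := ι.toAlgebra
  haveI : IsScalarTower (integralClosure A L) (integralClosure B L) L :=
    IsScalarTower.of_algebraMap_eq fun _ => rfl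
  haveI : IsScalarTower A (integralClosure A L) (integralClosure B L) :=
    IsScalarTower.of_algebraMap_eq fun _ => Subtype.ext rfl
  haveI : IsScalarTower A B (integralClosure B L) :=
    IsScalarTower.of_algebraMap_eq fun x => Subtype.ext (IsScalarTower.algebraMap_apply A B L x)
  haveI : IsLocalization (Algebra.algebraMapSubmonoid (integralClosure A L) M)
      (integralClosure B L) :=
    IsLocalization.integralClosure (S := L) (Rf := B) (Sf := L) M
  exact Module.Finite.of_isLocalization A (integralClosure A L) M

/-! ## In dimension one the punctured spectrum is the generic point: `K = R[1/a]` -/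

/-- In a local domain `R` of Krull dimension `≤ 1` with fraction field `K`, inverting any non-zero
element `a` of the maximal ideal gives the whole fraction field, `K = R[1/a]`: every non-zero `b ∈ R`
lies only in the prime `𝔪` (or in none), so `a ∈ √(b)`, i.e. `b` divides a power of `a`.
[folklore] -/
theorem isLocalization_away_of_ringKrullDim_le_one {R K : Type*} [CommRing R] [IsDomain R]
    [IsLocalRing R] [Field K] [Algebra R K] [IsFractionRing R K] (h1 : ringKrullDim R ≤ 1)
    {a : R} (ha : a ∈ IsLocalRing.maximalIdeal R) (ha0 : a ≠ 0) :
    IsLocalization.Away a K := by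
  haveI : Ring.DimensionLEOne R := Ring.DimensionLEOne.of_ringKrullDim_le_one h1
  -- every non-zero `b` divides a power of `a`
  have key : ∀ b : R, b ≠ 0 → ∃ (n : ℕ) (c : R), a ^ n = b * c := by
    intro b hb0
    have hrad : a ∈ (Ideal.span {b}).radical := by
      rw [Ideal.radical_eq_sInf, Submodule.mem_sInf]
      rintro P ⟨hbP, hP⟩
      have hP0 : P ≠ ⊥ := fun h => hb0 (by
        have hb : b ∈ P := hbP (Ideal.mem_span_singleton_self b)
        rwa [h, Ideal.mem_bot] at hb)
      rw [IsLocalRing.eq_maximalIdeal (Ring.DimensionLEOne.maximalOfPrime hP0 hP)]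
      exact ha
    obtain ⟨n, hn⟩ := hrad
    obtain ⟨c, hc⟩ := Ideal.mem_span_singleton'.mp hn
    exact ⟨n, c, by rw [← hc, mul_comm]⟩
  refine (isLocalization_iff _ K).mpr ⟨?_, ?_, ?_⟩
  · rintro ⟨_, n, rfl⟩
    exact isUnit_iff_ne_zero.mpr
      ((map_ne_zero_iff (algebraMap R K) (IsFractionRing.injective R K)).mpr (pow_ne_zero n ha0))
  · intro z
    obtain ⟨⟨r, s⟩, hz⟩ := IsLocalization.surj (nonZeroDivisors R) z
    obtain ⟨n, c, hc⟩ := key s (nonZeroDivisors.ne_zero s.2)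
    refine ⟨⟨r * c, ⟨a ^ n, n, rfl⟩⟩, ?_⟩
    change z * algebraMap R K (a ^ n) = algebraMap R K (r * c)
    rw [hc, map_mul, ← mul_assoc, hz, map_mul]
  · intro x y hxy
    exact ⟨1, by simpa using IsFractionRing.injective R K hxy⟩

/-- If `K = R[1/a]` for an `R`-algebra `K` (a field), then `K = B[1/a]` for every intermediate
ring `R → B ↪ K`. [folklore] -/
theorem isLocalization_away_of_intermediate {R B K : Type*} [CommRing R] [CommRing B] [Field K]
    [Algebra R K] [Algebra R B] [Algebra B K] [IsScalarTower R B K]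
    (hinj : Function.Injective (algebraMap B K)) (a : R) [IsLocalization.Away a K] :
    IsLocalization.Away (algebraMap R B a) K := by
  refine (isLocalization_iff _ K).mpr ⟨?_, ?_, ?_⟩
  · rintro ⟨_, n, rfl⟩
    rw [map_pow, ← IsScalarTower.algebraMap_apply R B K]
    exact (IsLocalization.Away.algebraMap_isUnit (S := K) a).pow n
  · intro z
    obtain ⟨⟨r, _, n, rfl⟩, hz⟩ := IsLocalization.surj (Submonoid.powers a) z
    refine ⟨⟨algebraMap R B r, ⟨_, n, rfl⟩⟩, ?_⟩
    change z * algebraMap B K (algebraMap R B a ^ n) = algebraMap B K (algebraMap R B r)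
    rw [← map_pow, ← IsScalarTower.algebraMap_apply, ← IsScalarTower.algebraMap_apply]
    exact hz
  · intro x y hxy
    exact ⟨1, by simpa using hinj hxy⟩

/-! ## The normalisation of a one-dimensional local domain resolves it -/

/-- The spectrum of a regular ring (a Noetherian ring all of whose localizations at primes are
regular local rings, e.g. a Dedekind domain) is a regular scheme: the stalk of `Spec D` at `𝔭` is
`D_𝔭`. [folklore] -/
theorem isRegular_Spec_of_isRegularRing (D : Type u) [CommRing D] [IsRegularRing D] :
    Scheme.IsRegular (Spec (.of D)) := by
  intro w
  have e₀ : Localization.AtPrime w.asIdeal ≃+* (Spec (.of D)).presheaf.stalk w :=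
    (StructureSheaf.stalkIso D w).toRingEquiv
  exact IsRegularLocalRing.of_ringEquiv e₀

/-- **A one-dimensional Noetherian local domain with finite normalisation is resolved by its
normalisation** (Kollár 2007, §1.4, Thm. 1.30: a normal Noetherian domain of dimension one is
regular). Let `R` be a Noetherian local domain of Krull dimension `1` with fraction field `K` whose
integral closure `R̃ ⊆ K` is a finite `R`-module. Then `π : Spec R̃ → Spec R` is a resolution of
singularities: `π` is finite, hence proper; for `0 ≠ a ∈ 𝔪` the open `D(a) ⊆ Spec R` is the generic
point, dense, its preimage `D(a) ⊆ Spec R̃` is dense, and `π` is an isomorphism over `D(a)` since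
`Spec K → Spec R̃ → Spec R` are open immersions onto `D(a)` (`R[1/a] = K = R̃[1/a]`); and `R̃` is a
Dedekind domain, so every stalk of `Spec R̃` is a field or a discrete valuation ring, i.e. regular.
[cite: Kollar2007, Thm. 1.30] -/
theorem hasResolution_Spec_of_finite_integralClosure (R K : Type u) [CommRing R] [IsDomain R]
    [IsNoetherianRing R] [IsLocalRing R] [Field K] [Algebra R K] [IsFractionRing R K]
    (h1 : ringKrullDim R = 1) (hfin : Module.Finite R (integralClosure R K)) :
    Scheme.HasResolution (Spec (.of R)) := by
  haveI : Ring.DimensionLEOne R := Ring.DimensionLEOne.of_ringKrullDim_le_one h1.le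
  haveI : IsDedekindDomain (integralClosure R K) := isDedekindDomain_integralClosure R K hfin
  haveI : IsFinite (Spec.map (CommRingCat.ofHom (algebraMap R (integralClosure R K)))) := by
    rw [IsFinite.SpecMap_iff, CommRingCat.hom_ofHom, RingHom.finite_algebraMap]
    exact hfin
  -- a non-zero element of the maximal ideal (`dim R = 1`, so `R` is not a field)
  have hm : IsLocalRing.maximalIdeal R ≠ ⊥ := fun hbot => by
    have h0 := ringKrullDim_eq_zero_of_isField
      ((IsLocalRing.isField_iff_maximalIdeal_eq (R := R)).mpr hbot)
    rw [h1] at h0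
    exact one_ne_zero h0
  obtain ⟨a, ha, ha0⟩ := Submodule.exists_mem_ne_zero_of_ne_bot hm
  haveI : IsLocalization.Away a K := isLocalization_away_of_ringKrullDim_le_one h1.le ha ha0
  haveI : IsLocalization.Away (algebraMap R (integralClosure R K) a) K :=
    isLocalization_away_of_intermediate (B := integralClosure R K) Subtype.val_injective a
  have ha0' : algebraMap R (integralClosure R K) a ≠ 0 := fun h0 => ha0
    (IsFractionRing.injective R K (by
      rw [map_zero, IsScalarTower.algebraMap_apply R (integralClosure R K) K, h0, map_zero]))
  have hpre : Spec.map (CommRingCat.ofHom (algebraMap R (integralClosure R K))) ⁻¹ᵁ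
      PrimeSpectrum.basicOpen a = PrimeSpectrum.basicOpen (algebraMap R (integralClosure R K) a) := by
    ext x
    exact Iff.rfl
  refine ⟨Spec (.of (integralClosure R K)),
    Spec.map (CommRingCat.ofHom (algebraMap R (integralClosure R K))), inferInstance,
    ⟨PrimeSpectrum.basicOpen a, dense_basicOpen_of_ne_zero a ha0, ?_, ?_⟩,
    isRegular_Spec_of_isRegularRing (integralClosure R K)⟩
  · rw [hpre]
    exact dense_basicOpen_of_ne_zero _ ha0'
  · -- an isomorphism over `D(a)`: both `D(a) ⊆ Spec R` and its preimage are `Spec K`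
    have hjπ : Spec.map (CommRingCat.ofHom (algebraMap (integralClosure R K) K)) ≫
        Spec.map (CommRingCat.ofHom (algebraMap R (integralClosure R K))) =
          Spec.map (CommRingCat.ofHom (algebraMap R K)) := by
      rw [← Spec.map_comp, ← CommRingCat.ofHom_comp, ← IsScalarTower.algebraMap_eq]
    haveI : IsOpenImmersion (Spec.map (CommRingCat.ofHom (algebraMap (integralClosure R K) K))) :=
      IsOpenImmersion.of_isLocalization (algebraMap R (integralClosure R K) a)
    haveI : IsOpenImmersion (Spec.map (CommRingCat.ofHom (algebraMap (integralClosure R K) K)) ≫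
        Spec.map (CommRingCat.ofHom (algebraMap R (integralClosure R K)))) := by
      rw [hjπ]
      exact IsOpenImmersion.of_isLocalization a
    refine isIso_morphismRestrict_of_isOpenImmersion _ _
      (Spec.map (CommRingCat.ofHom (algebraMap (integralClosure R K) K))) ?_ ?_
    · rw [hpre]
      exact PrimeSpectrum.localization_away_comap_range K (algebraMap R (integralClosure R K) a)
    · rw [hjπ]
      exact PrimeSpectrum.localization_away_comap_range K a

/-! ## The registered sub-goal -/

/-- **One-dimensional variety germs have a proper birational regular model** (registered sub-goal
`regularModel_of_ringKrullDim_eq_one` of line `socle-discrepancy-certificate`, verbatim: the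
dimension-one case of `stub_isolatedSingularityResidual`, where GOOD stalks are even regular). Let `R`
be a Noetherian local domain of Krull dimension `1` which is a local ring `𝒪_{Y,y}` of an integral
scheme `Y` locally of finite type over a field `k` (`hgerm`). Then some `W → Spec R` is proper and
birational with all stalks of `W` regular — namely the normalisation: `R ≅ 𝒪_{Y,y} = A_𝔭` for the
finitely generated `k`-domain `A = Γ(Y, U)` of an affine neighbourhood `U ∋ y`, whose normalisation is
finite (E. Noether, `NoetherFiniteIntegralClosure_holds`), so the normalisation of `R` is finite
(`module_finite_integralClosure_of_isLocalization`) and `hasResolution_Spec_of_finite_integralClosure`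
applies (Kollár 2007, §1.4, Thms. 1.30 and 1.33). The characteristic, separatedness and
quasi-compactness hypotheses are not used. [cite: Kollar2007, Thm. 1.30] -/
theorem regularModel_of_ringKrullDim_eq_one
    (p : ℕ) [Fact p.Prime] (R : Type) [CommRing R] [IsNoetherianRing R] [IsLocalRing R] [IsDomain R] [CharP
    R p] (hgerm : ∃ (k : Type) (_ : Field k) (_ : CharP k p) (Y : Scheme.{0}) (g : Y ⟶ Spec (.of k)) (_ :
    IsSeparated g) (_ : LocallyOfFiniteType g) (_ : QuasiCompact g) (_ : IsIntegral Y) (y : Y), Nonempty (R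
    ≃+* Y.presheaf.stalk y)) (h1 : ringKrullDim R = 1) : ∃ (W : Scheme.{0}) (π : W ⟶ Spec (.of R)), IsProper
    π ∧ IsBirational π ∧ ∀ w : W, IsRegularLocalRing (W.presheaf.stalk w) := by
  obtain ⟨k, _instk, _chark, Y, g, _sep, _lft, _qc, _int, y, ⟨e⟩⟩ := hgerm
  -- an affine open neighbourhood `U = Spec A` of `y`
  obtain ⟨_, ⟨U, hU, rfl⟩, hyU, -⟩ :=
    Y.isBasis_affineOpens.exists_subset_of_mem_open (Set.mem_univ y) isOpen_univ
  haveI : Nonempty U := ⟨⟨y, hyU⟩⟩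
  -- `A = Γ(Y, U)` is a finitely generated `k`-domain with fraction field `K(Y)`
  let φ : k →+* Γ(Y, U) := (g.appLE ⊤ U le_top).hom.comp (Scheme.ΓSpecIso (.of k)).inv.hom
  have hφ : φ.FiniteType := by
    refine RingHom.FiniteType.comp ?_ (RingHom.FiniteType.of_surjective _
      (Scheme.ΓSpecIso (.of k)).symm.commRingCatIsoToRingEquiv.surjective)
    exact HasRingHomProperty.appLE @LocallyOfFiniteType g ‹_› ⟨⊤, isAffineOpen_top _⟩ ⟨U, hU⟩
      le_top
  letI : Algebra k Γ(Y, U) := φ.toAlgebra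
  haveI : Algebra.FiniteType k Γ(Y, U) := hφ
  haveI : IsFractionRing Γ(Y, U) Y.functionField :=
    functionField_isFractionRing_of_isAffineOpen Y U hU
  -- the stalk `𝒪_{Y,y} ≅ R` is the localization of `A` at the prime of `y`
  letI := Y.presheaf.algebra_section_stalk (⟨y, hyU⟩ : U)
  haveI := hU.isLocalization_stalk ⟨y, hyU⟩
  haveI : IsScalarTower Γ(Y, U) (Y.presheaf.stalk y) Y.functionField :=
    functionField_isScalarTower Y U ⟨y, hyU⟩
  letI : Algebra Γ(Y, U) R :=
    (e.symm.toRingHom.comp (algebraMap Γ(Y, U) (Y.presheaf.stalk y))).toAlgebra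
  letI : Algebra R Y.functionField :=
    ((algebraMap (Y.presheaf.stalk y) Y.functionField).comp e.symm.symm.toRingHom).toAlgebra
  haveI : IsScalarTower Γ(Y, U) R Y.functionField := IsScalarTower.of_algebraMap_eq fun x => by
    change algebraMap Γ(Y, U) Y.functionField x = algebraMap (Y.presheaf.stalk y) Y.functionField
      (e.symm.symm (e.symm (algebraMap Γ(Y, U) (Y.presheaf.stalk y) x)))
    rw [e.symm.symm_apply_apply, ← IsScalarTower.algebraMap_apply]
  haveI : IsLocalization.AtPrime R (hU.primeIdealOf ⟨y, hyU⟩).asIdeal :=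
    IsLocalization.isLocalization_of_algEquiv (hU.primeIdealOf ⟨y, hyU⟩).asIdeal.primeCompl
      (AlgEquiv.ofRingEquiv (f := e.symm) fun _ => rfl)
  haveI : IsFractionRing R Y.functionField :=
    (IsFractionRing.isFractionRing_iff_of_base_ringEquiv (S := Y.functionField) e.symm).mp
      inferInstance
  -- E. Noether: the normalisation of `A` is finite, hence so is that of `R = A_𝔭`
  have hfinA : Module.Finite Γ(Y, U) (integralClosure Γ(Y, U) Y.functionField) :=
    NoetherFiniteIntegralClosure_holds.self k Γ(Y, U) Y.functionField
  have hfinR : Module.Finite R (integralClosure R Y.functionField) :=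
    module_finite_integralClosure_of_isLocalization (hU.primeIdealOf ⟨y, hyU⟩).asIdeal.primeCompl
      hfinA
  obtain ⟨W, π, hπ⟩ := hasResolution_Spec_of_finite_integralClosure R Y.functionField h1 hfinR
  exact ⟨W, π, hπ.isProper, hπ.isBirational, hπ.isRegular⟩

end Summit.ResolutionOfSingularities.ResolutionOfSingularities.Theorems.FRationalModification.RegularModelDimOne

end
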